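import Mathlib
import Summits.Ventures.PercRepro2.ExplorationTreeCondExp

/-!
# Grafting explorations: the exploration filtration and the tower property (blind cell PercRepro2,
typer-1 g19; a language line)

A stopping exploration `t` can be CONTINUED at each of its leaves `ℓ` by a further tree `k ℓ`
(`graft t P k`): the finer exploration reveals everything the coarser one revealed and more.  The
σ-algebras of `ExplorationTreeCondExp.lean` then form a filtration and the pinned means satisfy the
tower property:

* `leaves_graft`: the leaves of the graft are the leaves of the continuations;
  `valid_graft`: the graft of valid trees is valid; `leafOf_graft`: the leaf reached by the graft is
  the leaf reached by the continuation at the leaf reached by `t`;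
* `leaf_eq_of_mem_leaves_graft`: the leaf of `t` is a function of the leaf of the graft;
* **`leafSigma_le_graft`**: `leafSigma t ≤ leafSigma (graft t root k)` — the exploration filtration;
* **`condExp_leafMean_graft`** (the tower property):
  `μ_p[leafMean p (graft t root k) f | leafSigma t] =ᵐ leafMean p t f` for every weight vector;
* `pin_pin`: pinning twice along an exploration is pinning once;
  **`expect_pin_eq_sum_leaves_pin`**: the leaf decomposition of a PINNED expectation,
  `E_{pin p P} f = Σ_{ℓ ∈ leaves t P} P_{pin p P}(ℓ) · E_{pin p ℓ} f` (any commutative ring);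
  `leafMean_graft_eq_sum`: the ring form of the tower property.

Identities only; nothing about the sign of any term.
-/

namespace Summit.Ventures.PercRepro2

open MeasureTheory ProbabilityTheory MeasureBridge

namespace ExplorationTree

/-! ## Grafting -/

section Graft

variable {E : Type*} [DecidableEq E]

/-- Continue the exploration `t` (started at `P`) at each of its leaves `ℓ` by the tree `k ℓ`. -/
def graft : ETree E → Partial E → (Partial E → ETree E) → ETree E
  | .leaf, P, k => k P
  | .node e t₀ t₁, P, k => .node e (graft t₀ (P.extend e false) k) (graft t₁ (P.extend e true) k)

/-- The leaves of a graft are the leaves of the continuations at the leaves of `t`. -/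
lemma leaves_graft (t : ETree E) :
    ∀ (P : Partial E) (k : Partial E → ETree E),
      leaves (graft t P k) P = (leaves t P).flatMap fun ℓ => leaves (k ℓ) ℓ := by
  induction t with
  | leaf =>
    intro P k
    simp [graft, leaves]
  | node e t₀ t₁ ih₀ ih₁ =>
    intro P k
    simp only [graft, leaves, ih₀, ih₁, List.flatMap_append]

/-- A leaf of `t` explores at least what `t`'s root explores. -/
lemma subset_of_mem_leaves (t : ETree E) :
    ∀ (P : Partial E), ∀ ℓ ∈ leaves t P, P.F ⊆ ℓ.F := by
  induction t with
  | leaf =>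
    intro P ℓ hℓ
    simp only [leaves, List.mem_singleton] at hℓ
    rw [hℓ]
  | node e t₀ t₁ ih₀ ih₁ =>
    intro P ℓ hℓ
    simp only [leaves, List.mem_append] at hℓ
    rcases hℓ with hℓ | hℓ
    · exact (Finset.subset_insert e P.F).trans (ih₀ _ ℓ hℓ)
    · exact (Finset.subset_insert e P.F).trans (ih₁ _ ℓ hℓ)

/-- The graft of a valid tree by valid continuations is valid. -/
lemma valid_graft (t : ETree E) :
    ∀ (P : Partial E) (k : Partial E → ETree E), Valid t P.F →
      (∀ ℓ ∈ leaves t P, Valid (k ℓ) ℓ.F) → Valid (graft t P k) P.F := by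
  induction t with
  | leaf =>
    intro P k _ hk
    exact hk P (by simp [leaves])
  | node e t₀ t₁ ih₀ ih₁ =>
    intro P k hv hk
    obtain ⟨he, hv₀, hv₁⟩ := hv
    refine ⟨he, ih₀ _ k hv₀ fun ℓ hℓ => hk ℓ ?_, ih₁ _ k hv₁ fun ℓ hℓ => hk ℓ ?_⟩
    · simp only [leaves, List.mem_append]
      exact Or.inl hℓ
    · simp only [leaves, List.mem_append]
      exact Or.inr hℓ

/-- The leaf reached by the graft is the leaf reached by the continuation at the leaf reached by
`t`. -/
lemma leafOf_graft (t : ETree E) :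
    ∀ (P : Partial E) (k : Partial E → ETree E) (ω : Config E),
      leafOf (graft t P k) P ω = leafOf (k (leafOf t P ω)) (leafOf t P ω) ω := by
  induction t with
  | leaf =>
    intro P k ω
    rfl
  | node e t₀ t₁ ih₀ ih₁ =>
    intro P k ω
    simp only [graft, leafOf_node]
    by_cases hωe : ω e = true
    · rw [if_pos hωe, if_pos hωe, ih₁]
    · rw [if_neg hωe, if_neg hωe, ih₀]

/-- On a leaf of the graft, the leaf of `t` is the leaf of `t` reached by the observed states:
the coarser leaf is a function of the finer one. -/
lemma leafOf_eq_leafOf_σ_of_mem_leaves_graft (t : ETree E) (k : Partial E → ETree E)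
    (hv : Valid t ∅) (hk : ∀ ℓ ∈ leaves t root, Valid (k ℓ) ℓ.F) (ω : Config E) :
    leafOf t root ω = leafOf t root (leafOf (graft t root k) root ω).σ := by
  have hω : ω ∈ (root : Partial E).event := by
    rw [root_event]
    trivial
  set ℓ := leafOf t root ω with hℓ
  have hℓmem : ℓ ∈ leaves t root := leafOf_mem_leaves t root ω
  have hωℓ : ω ∈ ℓ.event := mem_event_leafOf t root hv ω hω
  -- the leaf of the graft is a leaf of the continuation `k ℓ` started at `ℓ`
  have hg : leafOf (graft t root k) root ω = leafOf (k ℓ) ℓ ω := leafOf_graft t root k ω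
  have hmem' : leafOf (k ℓ) ℓ ω ∈ leaves (k ℓ) ℓ := leafOf_mem_leaves (k ℓ) ℓ ω
  -- its observed states lie in its own event, hence in `ℓ.event`
  have hσ : (leafOf (k ℓ) ℓ ω).σ ∈ (leafOf (k ℓ) ℓ ω).event := fun _ _ => rfl
  have hσℓ : (leafOf (k ℓ) ℓ ω).σ ∈ ℓ.event :=
    event_subset_of_mem_leaves (k ℓ) ℓ (hk ℓ hℓmem) _ hmem' hσ
  rw [hg]
  exact (leafOf_eq_of_mem_event t root hv ℓ hℓmem _ hσℓ).symm

/-- **The exploration filtration**: continuing an exploration refines its σ-algebra. -/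
theorem leafSigma_le_graft (t : ETree E) (k : Partial E → ETree E) (hv : Valid t ∅)
    (hk : ∀ ℓ ∈ leaves t root, Valid (k ℓ) ℓ.F) :
    leafSigma t ≤ leafSigma (graft t root k) := by
  rintro s ⟨T, -, rfl⟩
  refine ⟨(fun ℓ' => leafOf t root ℓ'.σ) ⁻¹' T, trivial, ?_⟩
  ext ω
  simp only [Set.mem_preimage]
  rw [← leafOf_eq_leafOf_σ_of_mem_leaves_graft t k hv hk ω]

end Graft

/-! ## The tower property -/

section Tower

variable {E : Type*} [Fintype E] [DecidableEq E]

/-- **The tower property of the pinned means**: the pinned mean of the finer exploration,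
conditioned on the coarser one, is the pinned mean of the coarser one. -/
theorem condExp_leafMean_graft (p : E → ℝ) (hp : IsProbVec p) (t : ETree E)
    (k : Partial E → ETree E) (hv : Valid t ∅) (hk : ∀ ℓ ∈ leaves t root, Valid (k ℓ) ℓ.F)
    (f : Config E → ℝ) :
    (percMeasureOf p hp)[leafMean p (graft t root k) f | leafSigma t] =ᵐ[percMeasureOf p hp]
      leafMean p t f := by
  have hvg : Valid (graft t root k) ∅ := valid_graft t root k hv hk
  have h1 := condExp_congr_ae (m := leafSigma t) (μ := percMeasureOf p hp)
    (condExp_leafSigma p hp (graft t root k) hvg f).symm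
  refine h1.trans ?_
  refine (condExp_condExp_of_le (leafSigma_le_graft t k hv hk) (leafSigma_le (graft t root k))).trans ?_
  exact condExp_leafSigma p hp t hv f

end Tower

/-! ## The ring form: pinning twice, the leaf decomposition of a pinned expectation -/

section Ring

variable {E : Type*} [Fintype E] [DecidableEq E] {R : Type*} [CommRing R]

omit [Fintype E] in
/-- Pinning twice along an exploration is pinning once: `pin (pin p P) ℓ = pin p ℓ` when `ℓ`
explores at least `P`. -/
lemma pin_pin (p : E → R) (P ℓ : Partial E) (h : P.F ⊆ ℓ.F) : pin (pin p P) ℓ = pin p ℓ := by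
  funext e
  by_cases he : e ∈ ℓ.F
  · rw [pin_of_mem _ ℓ he, pin_of_mem _ ℓ he]
  · have heP : e ∉ P.F := fun h' => he (h h')
    rw [pin_of_notMem _ ℓ he, pin_of_notMem _ ℓ he, pin_of_notMem _ P heP]

/-- The pinned expectation only sees the root event. -/
lemma expect_pin_indicator_event (p : E → R) (P : Partial E) (f : Config E → R) :
    expect (pin p P) (P.event.indicator f) = expect (pin p P) f :=
  expect_pin_congr p P fun _ hω => Set.indicator_of_mem hω f

/-- **The leaf decomposition of a pinned expectation**: for a valid tree started at `P`,
`E_{pin p P} f = Σ_{ℓ ∈ leaves t P} P_{pin p P}(ℓ) · E_{pin p ℓ} f`. -/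
theorem expect_pin_eq_sum_leaves_pin (p : E → R) (t : ETree E) (P : Partial E) (hv : Valid t P.F)
    (f : Config E → R) :
    expect (pin p P) f =
      ((leaves t P).map fun ℓ => prob (pin p P) ℓ.event * expect (pin p ℓ) f).sum := by
  classical
  have h := expect_indicator_preimage_leafOf (pin p P) t P hv Set.univ f
  rw [Set.preimage_univ, Set.univ_inter, expect_pin_indicator_event] at h
  rw [h]
  congr 1
  refine List.map_congr_left fun ℓ hℓ => ?_
  rw [if_pos (Set.mem_univ ℓ), expect_indicator_event, pin_pin p P ℓ (subset_of_mem_leaves t P ℓ hℓ)]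

/-- The ring form of the tower property: the pinned mean of `t` at `ω` is the leaf-weighted sum of
the pinned means of the continuation at the leaf of `t` reached by `ω`. -/
theorem leafMean_graft_eq_sum (p : E → ℝ) (t : ETree E) (k : Partial E → ETree E)
    (hk : ∀ ℓ ∈ leaves t root, Valid (k ℓ) ℓ.F) (f : Config E → ℝ) (ω : Config E) :
    leafMean p t f ω =
      ((leaves (k (leafOf t root ω)) (leafOf t root ω)).map fun ℓ =>
        prob (pin p (leafOf t root ω)) ℓ.event * expect (pin p ℓ) f).sum :=
  expect_pin_eq_sum_leaves_pin p (k (leafOf t root ω)) (leafOf t root ω)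
    (hk _ (leafOf_mem_leaves t root ω)) f

end Ring

end ExplorationTree

end Summit.Ventures.PercRepro2
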